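import Literature.Topology.FourManifolds.KirbyCircleSurgeryStep
import Literature.Topology.FourManifolds.SurgeryKillsLoop
import Literature.Topology.FourManifolds.LoopsAsEmbeddedCircles
import Literature.Topology.FourManifolds.CircleSurgeryProofs
import Literature.Topology.FourManifolds.IntersectionLatticeOrientationIffProofs
import Literature.Topology.FourManifolds.BordismFourTransitivity
import Literature.Topology.FourManifolds.BordismFourOrientableBoundary
import Literature.AlgebraicTopology.FundamentalGroup.CompactManifoldFundamentalGroupFG
import HarnessLib

/-!
# Kirby's `W₁`: a closed oriented 4-manifold is oriented-bordant, with the same signature, to a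
# simply connected one (Kirby 1989, VIII Thm 1(A), first step of the proof)

Topic `Literature/Topology/FourManifolds` (fact seat of
`Literature.Topology.FourManifolds.isOrientedBordant_of_isEmpty_of_signature_eq_zero`, Kirby
1989, Cor. IX.2 with VIII Thm 1(A)).  R. C. Kirby, *The Topology of 4-Manifolds* (1989),
Ch. VIII, proof of Thm 1(A): *"First we make `M` 1-connected by adding 2-handles to `M × I`
along circles `γ × 1` … This gives a bordism `W₁` from `M` to `M₁`."*  Assembled here from the
tree:

1. `π₁(M, x₀)` is finitely generated (`fundamentalGroup_fg_of_compactSpace_chartedSpace`), so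
   it is the normal closure of a finite set `S`; induct on `#S`.
2. A class `g ∈ S` is represented by a smoothly embedded circle `e` through `x₀`
   (`exists_isSmoothEmbedding_circleLoop_eq`: Whitney 1936 / Milnor 1965 Lemma 6.12).
3. `M` is `ℤ`-oriented, hence smoothly orientable (`isOrientable_of_isOrientableOver_int`), so
   `e` has a tubular neighbourhood `S¹ × ℝ³ ↪ M` (`nonempty_circleNbhd_holds`: Hirsch 4.4.2),
   i.e. `e` is the core of a one-member framed family.
4. Surgery along it (the trace is an oriented bordism: Milnor 1965 Thm. 3.12,
   `exists_connectedSpace_isSurgery_isOrientedBordant_signature_eq`) yields a connected closed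
   `M′`, oriented-bordant to `M` with the same signature, and `π₁(M′)` is the normal closure of
   the image of `S ∖ {g}` (`IsSurgery.exists_surjective_normalClosure_eq_top`: Kosinski X,
   Lemma 1.2).
5. Oriented bordism is transitive (`IsOrientedBordant.trans`, Thom 1954 IV §1).

* `exists_simplyConnectedSpace_isOrientedBordant_signature_eq` — **for a connected closed
  smooth `ℤ`-oriented 4-manifold `(M, μ)` there is a simply connected closed smooth 4-manifold
  `M₁` with a `ℤ`-orientation `μ₁` such that `(M, μ) ∼ (M₁, μ₁)` are oriented-bordant and
  `σ(M₁, μ₁) = σ(M, μ)`.**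
* `exists_simplyConnectedSpace_isOrientedBordant_signature_eq_of_nonempty` — the same for
  every nonempty closed `ℤ`-oriented `M : Type` (every class of `Ω₄` has a simply connected
  representative with the same signature);
* `isOrientedBordant_of_isEmpty_of_signature_eq_zero_of_simplyConnected`,
  `isOrientedBordant_of_isEmpty_of_signature_eq_zero_of_simplyConnected_smoothOrientation` —
  consequently Kirby's Cor. IX.2 (the named fact
  `isOrientedBordant_of_isEmpty_of_signature_eq_zero`, every universe) follows from its case of
  SIMPLY CONNECTED closed oriented 4-manifolds `M : Type`: *a simply connected closed smooth
  4-manifold of signature zero bounds an oriented 5-manifold* — the remaining content of Kirby's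
  VIII Thm 1(A) (`W₂ ∪ W₃ ∪ W₄`: immersion into `ℝ⁶`, removal of triple and double points, Seifert
  manifold) together with IX Thm 1 (`p₁ = 3σ`).

Everything is proved; no definitions, no named facts.

## References

* R. C. Kirby, *The Topology of 4-Manifolds*, LNM 1374 (1989), Ch. VIII, proof of Thm 1(A)
  (first paragraph); Cor. IX.2. [Kirby1989]
* J. Milnor, *Lectures on the h-cobordism theorem* (1965), Thm. 3.12. [MilnorHCobordism1965]
* A. A. Kosinski, *Differential Manifolds* (1993), Ch. X §1, Lemma (1.2). [Kosinski1993]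
-/

noncomputable section

open scoped Manifold ContDiff Topology
open Set Function Module
open Literature.AlgebraicTopology.SingularHomology
open Literature.AlgebraicTopology.FundamentalGroup
open Literature.AlgebraicTopology.FundamentalGroup.VanKampen

namespace Literature.Topology.FourManifolds

universe u

/-- Local notation: `𝔼 n` is the model Euclidean space `EuclideanSpace ℝ (Fin n)`. -/
local notation "𝔼 " n:arg => EuclideanSpace ℝ (Fin n)

/-- The induction behind Kirby's `W₁`: if `π₁(M, x₀)` is the normal closure of at most `r`
elements, then `r` circle surgeries make `M` simply connected, through oriented bordisms
preserving the signature. [cite: Kirby1989, Ch. VIII Thm 1(A) (proof)] -/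
private theorem kirby_W1_aux (r : ℕ) : ∀ {M : Type} [TopologicalSpace M] [ChartedSpace (𝔼 4) M]
    [T2Space M] [SecondCountableTopology M] [CompactSpace M] [IsManifold (𝓡 4) ∞ M]
    [ConnectedSpace M] (μ : HomologicalOrientation ℤ M 4) (x₀ : M)
    (S : Finset (_root_.FundamentalGroup M x₀)), S.card ≤ r →
    Subgroup.normalClosure (S : Set (_root_.FundamentalGroup M x₀)) = ⊤ →
    ∃ (M' : Type) (_ : TopologicalSpace M') (_ : ChartedSpace (𝔼 4) M')
      (_ : IsManifold (𝓡 4) ∞ M') (_ : CompactSpace M') (_ : T2Space M')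
      (_ : SecondCountableTopology M') (_ : SimplyConnectedSpace M')
      (μ' : HomologicalOrientation ℤ M' 4),
      IsOrientedBordant 4 μ μ' ∧ μ'.signature = μ.signature := by
  classical
  induction r with
  | zero =>
    intro M _ _ _ _ _ _ _ μ x₀ S hcard hS
    have hS0 : S = ∅ := Finset.card_eq_zero.1 (Nat.le_zero.1 hcard)
    subst hS0
    rw [Finset.coe_empty, Subgroup.normalClosure_empty] at hS
    haveI : Subsingleton (_root_.FundamentalGroup M x₀) := by
      refine ⟨fun a b => ?_⟩
      have ha : a ∈ (⊥ : Subgroup (_root_.FundamentalGroup M x₀)) := by rw [hS]; trivial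
      have hb : b ∈ (⊥ : Subgroup (_root_.FundamentalGroup M x₀)) := by rw [hS]; trivial
      rw [Subgroup.mem_bot] at ha hb
      rw [ha, hb]
    haveI := ChartedSpace.locallyPathConnectedSpace (𝔼 4) M
    haveI : PathConnectedSpace M := pathConnectedSpace_iff_connectedSpace.2 ‹_›
    haveI : SimplyConnectedSpace M := simplyConnectedSpace_of_subsingleton x₀
    exact ⟨M, inferInstance, inferInstance, inferInstance, inferInstance, inferInstance,
      inferInstance, this, μ, isOrientedBordant_refl μ, rfl⟩
  | succ r ih =>
    intro M _ _ _ _ _ _ _ μ x₀ S hcard hS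
    by_cases hle : S.card ≤ r
    · exact ih μ x₀ S hle hS
    obtain ⟨g, hg⟩ : S.Nonempty := S.card_pos.1 (by omega)
    -- ### (2) an embedded circle through `x₀` in the class `g`
    obtain ⟨e, hemb, h0, hge⟩ := exists_isSmoothEmbedding_circleLoop_eq (n := 4) (by norm_num) x₀ g
    -- ### (3) a framing of it
    haveI : IsManifold (𝓡 4) 1 M := IsManifold.of_le (n := ∞) (by simp)
    have hX : IsOrientable (𝓡 4) M := isOrientable_of_isOrientableOver_int M ⟨μ⟩
    obtain ⟨ν⟩ := nonempty_circleNbhd_holds hX e hemb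
    let νF : FramedSphereFamily (𝓡 4) M Unit 1 3 :=
      ⟨fun _ => ν.toFun, fun _ => ν.isSmoothEmbedding, fun _ => ν.isOpen_range,
        fun i j hij => absurd (Subsingleton.elim i j) hij⟩
    have hc : ∀ v, e v = νF.sphere default v := fun v => (ν.apply_zero v).symm
    -- ### (4) surgery along it
    obtain ⟨M₁, i₁, i₂, i₃, i₄, i₅, i₆, i₇, μ₁, hs, hb, hσ⟩ :=
      exists_connectedSpace_isSurgery_isOrientedBordant_signature_eq νF μ
    haveI := ChartedSpace.locallyPathConnectedSpace (𝔼 4) M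
    haveI : PathConnectedSpace M := pathConnectedSpace_iff_connectedSpace.2 ‹_›
    obtain ⟨p₀, Φ, -, hgen⟩ := hs.exists_surjective_normalClosure_eq_top (le_refl 2) e hc h0
      (S : Set (_root_.FundamentalGroup M x₀)) hS
    rw [hge] at hgen
    -- the surviving normal generators
    set S₁ : Finset (_root_.FundamentalGroup M₁ p₀) := (S.erase g).image Φ with hS₁def
    have hS₁ : (S₁ : Set (_root_.FundamentalGroup M₁ p₀)) =
        Φ '' ((S : Set (_root_.FundamentalGroup M x₀)) \ {g}) := by
      rw [hS₁def, Finset.coe_image, Finset.coe_erase]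
    have hcard₁ : S₁.card ≤ r := by
      refine Finset.card_image_le.trans ?_
      rw [Finset.card_erase_of_mem hg]
      omega
    obtain ⟨M₂, j₁, j₂, j₃, j₄, j₅, j₆, j₇, μ₂, hb₂, hσ₂⟩ :=
      ih μ₁ p₀ S₁ hcard₁ (by rw [hS₁]; exact hgen)
    -- ### (5) compose the bordisms
    exact ⟨M₂, j₁, j₂, j₃, j₄, j₅, j₆, j₇, μ₂, hb.trans hb₂, hσ₂.trans hσ⟩

/-- **Kirby 1989, VIII Thm 1(A), proof, first step (`W₁`): a connected closed smooth
`ℤ`-oriented 4-manifold `(M, μ)` is oriented-bordant, with the same signature, to a SIMPLY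
CONNECTED closed smooth 4-manifold** — by finitely many surgeries on framed embedded circles
representing normal generators of the finitely generated group `π₁(M)`, each through an oriented
trace. [cite: Kirby1989, Ch. VIII Thm 1(A) (proof)] -/
theorem exists_simplyConnectedSpace_isOrientedBordant_signature_eq {M : Type}
    [TopologicalSpace M] [ChartedSpace (𝔼 4) M] [T2Space M] [SecondCountableTopology M]
    [CompactSpace M] [IsManifold (𝓡 4) ∞ M] [ConnectedSpace M]
    (μ : HomologicalOrientation ℤ M 4) :
    ∃ (M' : Type) (_ : TopologicalSpace M') (_ : ChartedSpace (𝔼 4) M')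
      (_ : IsManifold (𝓡 4) ∞ M') (_ : CompactSpace M') (_ : T2Space M')
      (_ : SecondCountableTopology M') (_ : SimplyConnectedSpace M')
      (μ' : HomologicalOrientation ℤ M' 4),
      IsOrientedBordant 4 μ μ' ∧ μ'.signature = μ.signature := by
  classical
  obtain ⟨x₀⟩ := (inferInstance : Nonempty M)
  -- ### (1) finitely many normal generators
  haveI : Group.FG (_root_.FundamentalGroup M x₀) :=
    fundamentalGroup_fg_of_compactSpace_chartedSpace (E := 𝔼 4) x₀
  obtain ⟨S, hS⟩ := (Group.fg_def.1 ‹_›)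
  refine kirby_W1_aux S.card μ x₀ S le_rfl ?_
  rw [eq_top_iff, ← hS]
  exact Subgroup.closure_le_normalClosure

/-- **Every four-dimensional oriented bordism class has a simply connected representative with
the same signature** (Kirby 1989, VIII Thm 1(A), proof, `W₁`, preceded by the passage to a
connected representative of Cor. IX.2): a closed smooth `ℤ`-oriented nonempty `(M, μ)`,
`M : Type`, is oriented-bordant to a simply connected closed smooth `ℤ`-oriented `(M₁, μ₁)` with
`σ(M₁, μ₁) = σ(M, μ)` (`exists_connectedSpace_isOrientedBordant`, bordism invariance of the
signature `signature_eq_of_isOrientedBordant_holds`, then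
`exists_simplyConnectedSpace_isOrientedBordant_signature_eq`).
[cite: Kirby1989, Ch. VIII Thm 1(A) (proof) with Cor. IX.2] -/
theorem exists_simplyConnectedSpace_isOrientedBordant_signature_eq_of_nonempty {M : Type}
    [TopologicalSpace M] [ChartedSpace (𝔼 4) M] [T2Space M] [SecondCountableTopology M]
    [CompactSpace M] [IsManifold (𝓡 4) ∞ M] [Nonempty M]
    (μ : HomologicalOrientation ℤ M 4) :
    ∃ (M' : Type) (_ : TopologicalSpace M') (_ : ChartedSpace (𝔼 4) M')
      (_ : IsManifold (𝓡 4) ∞ M') (_ : CompactSpace M') (_ : T2Space M')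
      (_ : SecondCountableTopology M') (_ : SimplyConnectedSpace M')
      (μ' : HomologicalOrientation ℤ M' 4),
      IsOrientedBordant 4 μ μ' ∧ μ'.signature = μ.signature := by
  obtain ⟨C, _, _, _, _, _, _, _, γ, hγ⟩ :=
    exists_connectedSpace_isOrientedBordant (d := 3) (by norm_num) M μ
  have hσ : μ.signature = γ.signature := signature_eq_of_isOrientedBordant_holds μ γ hγ
  obtain ⟨M₁, j₁, j₂, j₃, j₄, j₅, j₆, j₇, μ₁, hb, hσ₁⟩ :=
    exists_simplyConnectedSpace_isOrientedBordant_signature_eq γ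
  exact ⟨M₁, j₁, j₂, j₃, j₄, j₅, j₆, j₇, μ₁, hγ.trans hb, hσ₁.trans hσ.symm⟩

/-! ### Kirby's Cor. IX.2 reduced to simply connected manifolds -/

/-- **Kirby's Cor. IX.2 follows from its simply connected case.**  If every simply connected
closed smooth `ℤ`-oriented 4-manifold `(M, μ)` of signature zero is oriented-bordant to the empty
manifold, then so is every closed smooth `ℤ`-oriented 4-manifold of signature zero, in every
universe (the named fact `isOrientedBordant_of_isEmpty_of_signature_eq_zero`): reduce to connected
`M : Type` (`isOrientedBordant_of_isEmpty_of_signature_eq_zero_of_connected'`), pass to a simply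
connected oriented-bordant `M₁` with the same signature (`W₁`,
`exists_simplyConnectedSpace_isOrientedBordant_signature_eq`) and compose the bordisms.
[cite: Kirby1989, Cor. IX.2 with VIII Thm 1(A) (proof)] -/
theorem isOrientedBordant_of_isEmpty_of_signature_eq_zero_of_simplyConnected
    (hsc : ∀ (M N : Type) [TopologicalSpace M] [T2Space M] [SecondCountableTopology M]
      [ChartedSpace (𝔼 4) M] [CompactSpace M] [IsManifold (𝓡 4) ∞ M] [SimplyConnectedSpace M]
      [TopologicalSpace N] [T2Space N] [SecondCountableTopology N]
      [ChartedSpace (𝔼 4) N] [CompactSpace N] [IsManifold (𝓡 4) ∞ N] [IsEmpty N]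
      (μ : HomologicalOrientation ℤ M 4) (ν : HomologicalOrientation ℤ N 4),
      μ.signature = 0 → IsOrientedBordant 4 μ ν) :
    isOrientedBordant_of_isEmpty_of_signature_eq_zero.{u} := by
  refine isOrientedBordant_of_isEmpty_of_signature_eq_zero_of_connected'
    fun M N _ _ _ _ _ _ _ _ _ _ _ _ _ _ μ ν hμ => ?_
  obtain ⟨M₁, _, _, _, _, _, _, _, μ₁, hb, hσ⟩ :=
    exists_simplyConnectedSpace_isOrientedBordant_signature_eq μ
  exact hb.trans (hsc M₁ N μ₁ ν (hσ.trans hμ))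

/-- **Kirby's Cor. IX.2 follows from VIII Thm 1(A) + IX Thm 1 for simply connected manifolds,
in Kirby's printed form**: if every simply connected closed smooth `ℤ`-oriented 4-manifold of
signature zero is the boundary of a compact smooth 5-manifold `W` carrying a smooth orientation,
then `isOrientedBordant_of_isEmpty_of_signature_eq_zero` holds in every universe (the relative
fundamental class of `(W, ∂W)` restricts to `±[M]`, `isOrientedBordant_of_isEmpty_of_connectedSpace`).
[cite: Kirby1989, Cor. IX.2 with VIII Thm 1(A) and IX Thm 1] -/
theorem isOrientedBordant_of_isEmpty_of_signature_eq_zero_of_simplyConnected_smoothOrientation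
    (hK : ∀ (M : Type) [TopologicalSpace M] [T2Space M] [SecondCountableTopology M]
      [ChartedSpace (𝔼 4) M] [CompactSpace M] [IsManifold (𝓡 4) ∞ M] [SimplyConnectedSpace M]
      (μ : HomologicalOrientation ℤ M 4), μ.signature = 0 →
      ∃ c : NullCobordism 4 M, Nonempty (SmoothOrientation (𝓡∂ 5) c.W)) :
    isOrientedBordant_of_isEmpty_of_signature_eq_zero.{u} := by
  refine isOrientedBordant_of_isEmpty_of_signature_eq_zero_of_simplyConnected
    fun M N _ _ _ _ _ _ _ _ _ _ _ _ _ _ μ ν hμ => ?_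
  obtain ⟨c, ⟨o⟩⟩ := hK M μ hμ
  obtain ⟨w, hw⟩ := c.exists_isRelFundamentalClass_of_smoothOrientation o
  exact isOrientedBordant_of_isEmpty_of_connectedSpace _ μ ν
    fun ν' => c.isOrientedBordant_boundaryOrientation_comap (n := 3) hw ν'

end Literature.Topology.FourManifolds
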